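import Mathlib.RingTheory.DedekindDomain.IntegralClosure
import Mathlib.RingTheory.DedekindDomain.PID
import Mathlib.RingTheory.DiscreteValuationRing.Basic
import Mathlib.RingTheory.Invariant.Basic
import Mathlib.NumberTheory.Multiplicity
import Literature.NumberTheory.GaloisRepresentations.RamificationFiltrationTowerProofs
import Literature.NumberTheory.GaloisRepresentations.LocalGaloisGroupHenselProofs
import Literature.NumberTheory.GaloisRepresentations.LocalGaloisGroupProofs
import HarnessLib

/-!
# Towards `absInertia_map_isCyclic`: the tame quotient `G_0/G_1` of a finite Galois `E/F`
is cyclic of order prime to `p` (trunk GalRep; Serre, *Local Fields*, Ch. IV §2, Cor. 1)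

D-0014 keeps `Literature/` sorry-free by stating cited results as named facts `def X : Prop`.
This sibling file of `Literature.NumberTheory.GaloisRepresentations.TameInertia` proves the
finite-level input of the named fact `Literature.NumberTheory.GaloisRepresentations.absInertia_map_isCyclic` (a tamely ramified
continuous `f : Γ_F → H` has `f(I_F)` cyclic of order prime to `p`): for a finite Galois
subextension `E/F` of `F̄`, `O_E` the integral closure of `𝒪[F]` in `E` and `𝔓_E = 𝔓 ∩ E`,

* `Literature.NumberTheory.GaloisRepresentations.isDiscreteValuationRing_integralClosure` — **`O_E` is a discrete valuation ring** with
  maximal ideal `𝔓_E` (Dedekind by `IsIntegralClosure.isDedekindDomain`, local because the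
  primes above `𝓂[F]` form one `Gal(E/F)`-orbit (`Algebra.IsInvariant.exists_smul_of_under_eq`)
  and `𝔓_E` is `Gal(E/F)`-stable, and a local Dedekind domain which is not a field is a DVR);
  Serre, *Local Fields*, Ch. II §2, Prop. 3 and Ch. I §4;
* `Literature.inertiaCharacter` — the homomorphism `θ₀ : G_0 → (O_E ⧸ 𝔓_E)ˣ`, `σ ↦ σ(π)/π mod 𝔓_E`
  (`π` a uniformiser), with **kernel exactly `G_1`** (`inertiaCharacter_eq_one_iff`);
  Serre, *Local Fields*, Ch. IV §2, Prop. 7 (`i = 0`);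
* `Literature.isCyclic_map_inertia_of_le_ker` — consequently, for every homomorphism `f` of
  `Gal(E/F)` killing `G_1`, the image `f(G_0)` is cyclic of order prime to `p`
  (a quotient of a subgroup of the cyclic group `(O_E ⧸ 𝔓_E)ˣ` of order `#k_E - 1`);
  Serre, *Local Fields*, Ch. IV §2, Cor. 1 of Prop. 7.

What separates this from `absInertia_map_isCyclic` itself is the surjectivity of
`I_F^v → Gal(E/F)^v` for small `v > 0` (Herbrand's theorem, `RamificationFiltration.herbrand_quotient`,
with `RamificationFiltrationTowerProofs.absUpperRamificationSubgroup_map_eq_of_herbrand_quotient`).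

## Proof of `ker θ₀ = G_1` without the structure `O_E = O_{E₀}[π]`

Serre derives `σ ∈ G_i ⇔ σ(π)/π ∈ U^i` from `i_G(σ) = v_E(σπ - π)`, which uses a generator of
`O_E` over the maximal unramified subring.  Here: if `σ ∈ G_0` and `σ π ≡ π (mod 𝔓_E²)` then
for every `x ∈ O_E`, writing `x = x^{q'} + a π` with `q' = #(O_E ⧸ 𝔓_E)` (`x ≡ x^{q'}` as the
residue field has `q'` elements), `σ(x^{q'}) - x^{q'} = (x + n)^{q'} - x^{q'} ∈ 𝔓_E²`
(`n = σx - x ∈ 𝔓_E`, `q' ∈ 𝔓_E`, `Mathlib.sq_dvd_add_pow_sub_sub`) and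
`σ(aπ) - aπ = σ(a)(σπ - π) + (σa - a)π ∈ 𝔓_E²`; hence `σ ∈ G_1`.

## References

* J.-P. Serre, *Local Fields*, GTM 67 (1979), Ch. I §4, §7 Prop. 22; Ch. II §2 Prop. 3;
  Ch. IV §1, §2 Prop. 7 and Cor. 1. [SerreLocalFields1979]
-/

noncomputable section

open scoped Pointwise Valued
open ValuativeRel Field

namespace Literature.NumberTheory.GaloisRepresentations

open GaloisRepresentations.IsNonarchimedeanLocalField

section DVR

variable (F : Type*) [Field F] [ValuativeRel F] [TopologicalSpace F] [IsNonarchimedeanLocalField F]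

omit [TopologicalSpace F] [IsNonarchimedeanLocalField F] in
/-- **Invariance `O_E^{Gal(E/F)} = 𝒪[F]`** for a finite Galois subextension `E/F` of `F̄`:
an element of `O_E` fixed by `Gal(E/F)` lies in `F` (Galois theory) and is integral over the
integrally closed `𝒪[F]`.  (Mathlib's `Algebra.isInvariant_of_isGalois`, restated for the
action of `E ≃ₐ[F] E` on the subalgebra `integralClosure 𝒪[F] E`.)
Ref: Serre, *Local Fields*, Ch. I §7. [folklore] -/
theorem isInvariant_integralClosure_of_isGalois (E : IntermediateField F (AlgebraicClosure F))
    [FiniteDimensional F E] [IsGalois F E] :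
    Algebra.IsInvariant 𝒪[F] (integralClosure 𝒪[F] E) (E ≃ₐ[F] E) := by
  refine ⟨fun b hb => ?_⟩
  have hb' : (b : E) ∈ IntermediateField.fixedField (⊤ : Subgroup (E ≃ₐ[F] E)) := by
    rintro ⟨g, -⟩
    exact congrArg Subtype.val (hb g)
  have htop : IntermediateField.fixedField (⊤ : Subgroup (E ≃ₐ[F] E)) = ⊥ :=
    ((IsGalois.tfae (F := F) (E := E)).out 0 1).mp (inferInstance : IsGalois F E)
  rw [htop, IntermediateField.mem_bot] at hb'
  obtain ⟨c, hc⟩ := hb'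
  have hbi : IsIntegral 𝒪[F] (b : E) := b.2
  rw [← hc, isIntegral_algebraMap_iff (algebraMap F E).injective] at hbi
  obtain ⟨a, rfl⟩ := IsIntegrallyClosed.algebraMap_eq_of_integral hbi
  refine ⟨a, Subtype.ext ?_⟩
  rw [Subalgebra.coe_algebraMap, IsScalarTower.algebraMap_apply 𝒪[F] F E]
  exact hc

/-- `𝔓_E = 𝔓 ∩ E` is stable under `Gal(E/F)` (every `g` lifts to `Γ_F`, and `σ • 𝔓 = 𝔓`).
Ref: Serre, *Local Fields*, Ch. II §2, Cor. 2 to Prop. 3. [folklore] -/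
theorem smul_comap_absMaximalIdeal (E : IntermediateField F (AlgebraicClosure F)) [Normal F E]
    (g : E ≃ₐ[F] E) :
    g • (absMaximalIdeal F).comap (E.integralClosureToAbsIntegers 𝒪[F]) =
      (absMaximalIdeal F).comap (E.integralClosureToAbsIntegers 𝒪[F]) := by
  obtain ⟨σ₀, hσ₀⟩ := AlgEquiv.restrictNormalHom_surjective (F := F) (K₁ := E) (AlgebraicClosure F) g
  have hσ : absRestrictNormalHom (K := F) E ((absoluteGaloisGroup.toAlgEquiv F).symm σ₀) = g := by
    rw [← hσ₀]; rfl
  rw [← hσ, ← IntermediateField.comap_integralClosureToAbsIntegers_smul, smul_absMaximalIdeal_holds]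

/-- Every maximal ideal of `O_E` is `𝔓_E` (the primes of `O_E` above `𝓂[F]` form one
`Gal(E/F)`-orbit and `𝔓_E` is a fixed point).
Ref: Serre, *Local Fields*, Ch. II §2, Prop. 3 (uniqueness of the prime above `𝓂[F]`). [folklore] -/
theorem eq_comap_absMaximalIdeal_of_isMaximal (E : IntermediateField F (AlgebraicClosure F))
    [FiniteDimensional F E] [IsGalois F E]
    (M : Ideal (integralClosure 𝒪[F] E)) [M.IsMaximal] :
    M = (absMaximalIdeal F).comap (E.integralClosureToAbsIntegers 𝒪[F]) := by
  haveI := isInvariant_integralClosure_of_isGalois F E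
  haveI : (absMaximalIdeal F).IsMaximal := absMaximalIdeal_isMaximal_holds F
  haveI := isMaximal_comap_integralClosureToAbsIntegers 𝒪[F] (absMaximalIdeal F) E
  have hQ : ((absMaximalIdeal F).comap (E.integralClosureToAbsIntegers 𝒪[F])).under 𝒪[F] = 𝓂[F] := by
    rw [under_comap_integralClosureToAbsIntegers, under_absMaximalIdeal_holds]
  have hM : M.under 𝒪[F] = 𝓂[F] := IsLocalRing.eq_maximalIdeal (Ideal.IsMaximal.under 𝒪[F] M)
  obtain ⟨g, hg⟩ := Algebra.IsInvariant.exists_smul_of_under_eq 𝒪[F] (integralClosure 𝒪[F] E)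
    (E ≃ₐ[F] E) ((absMaximalIdeal F).comap (E.integralClosureToAbsIntegers 𝒪[F])) M (hQ.trans hM.symm)
  rw [hg, smul_comap_absMaximalIdeal]

/-- `O_E` is a local ring (its unique maximal ideal is `𝔓_E`).
Ref: Serre, *Local Fields*, Ch. II §2, Prop. 3. [folklore] -/
theorem isLocalRing_integralClosure_intermediateField (E : IntermediateField F (AlgebraicClosure F))
    [FiniteDimensional F E] [IsGalois F E] : IsLocalRing (integralClosure 𝒪[F] E) := by
  haveI : (absMaximalIdeal F).IsMaximal := absMaximalIdeal_isMaximal_holds F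
  haveI := isMaximal_comap_integralClosureToAbsIntegers 𝒪[F] (absMaximalIdeal F) E
  refine IsLocalRing.of_unique_max_ideal ⟨(absMaximalIdeal F).comap (E.integralClosureToAbsIntegers 𝒪[F]),
    inferInstance, fun M hM => ?_⟩
  haveI := hM
  exact eq_comap_absMaximalIdeal_of_isMaximal F E M

/-- `𝔓_E` is non-zero (it contains the image of a uniformiser of `F`). [folklore] -/
theorem comap_absMaximalIdeal_ne_bot (E : IntermediateField F (AlgebraicClosure F)) :
    (absMaximalIdeal F).comap (E.integralClosureToAbsIntegers 𝒪[F]) ≠ ⊥ := by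
  obtain ⟨ϖ, hϖ⟩ := IsDiscreteValuationRing.exists_irreducible 𝒪[F]
  intro h
  have hmem : algebraMap 𝒪[F] (integralClosure 𝒪[F] E) ϖ ∈
      (absMaximalIdeal F).comap (E.integralClosureToAbsIntegers 𝒪[F]) := by
    rw [← Ideal.mem_comap, ← Ideal.under_def, under_comap_integralClosureToAbsIntegers,
      under_absMaximalIdeal_holds]
    exact hϖ.not_isUnit |> (IsLocalRing.mem_maximalIdeal _).mpr
  rw [h, Ideal.mem_bot, map_eq_zero_iff _ ?_] at hmem
  · exact hϖ.ne_zero hmem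
  · intro a b hab
    have := congrArg (fun y : integralClosure 𝒪[F] E => ((y : E) : AlgebraicClosure F)) hab
    simp only [Subalgebra.coe_algebraMap] at this
    change algebraMap 𝒪[F] (AlgebraicClosure F) a = algebraMap 𝒪[F] (AlgebraicClosure F) b at this
    rw [IsScalarTower.algebraMap_apply 𝒪[F] F (AlgebraicClosure F),
      IsScalarTower.algebraMap_apply 𝒪[F] F (AlgebraicClosure F)] at this
    exact IsFractionRing.injective 𝒪[F] F ((algebraMap F (AlgebraicClosure F)).injective this)

/-- **`O_E` is a discrete valuation ring** for a finite Galois subextension `E/F` of `F̄`: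
Dedekind (`IsIntegralClosure.isDedekindDomain`), local (`isLocalRing_integralClosure_intermediateField`), hence
principal (`IsPrincipalIdealRing.of_finite_maximals`), and not a field.
Ref: Serre, *Local Fields*, Ch. II §2, Prop. 3 and Ch. I §4. [cite: SerreLocalFields1979, Ch. II §2 Prop. 3] -/
theorem isDiscreteValuationRing_integralClosure (E : IntermediateField F (AlgebraicClosure F))
    [FiniteDimensional F E] [IsGalois F E] : IsDiscreteValuationRing (integralClosure 𝒪[F] E) := by
  haveI : IsDedekindDomain (integralClosure 𝒪[F] E) :=
    IsIntegralClosure.isDedekindDomain 𝒪[F] F E (integralClosure 𝒪[F] E)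
  haveI := isLocalRing_integralClosure_intermediateField F E
  haveI : IsPrincipalIdealRing (integralClosure 𝒪[F] E) := by
    refine IsPrincipalIdealRing.of_finite_maximals ?_
    refine (Set.finite_singleton (IsLocalRing.maximalIdeal (integralClosure 𝒪[F] E))).subset ?_
    intro M hM
    exact (IsLocalRing.eq_maximalIdeal hM)
  have hmax : IsLocalRing.maximalIdeal (integralClosure 𝒪[F] E) =
      (absMaximalIdeal F).comap (E.integralClosureToAbsIntegers 𝒪[F]) := by
    haveI : (absMaximalIdeal F).IsMaximal := absMaximalIdeal_isMaximal_holds F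
    haveI := isMaximal_comap_integralClosureToAbsIntegers 𝒪[F] (absMaximalIdeal F) E
    exact (IsLocalRing.eq_maximalIdeal inferInstance).symm
  exact { not_a_field' := by rw [hmax]; exact comap_absMaximalIdeal_ne_bot F E }

/-- The maximal ideal of the DVR `O_E` is `𝔓_E`. [folklore] -/
theorem maximalIdeal_integralClosure (E : IntermediateField F (AlgebraicClosure F))
    [FiniteDimensional F E] [IsGalois F E] :
    haveI := isLocalRing_integralClosure_intermediateField F E
    IsLocalRing.maximalIdeal (integralClosure 𝒪[F] E) =
      (absMaximalIdeal F).comap (E.integralClosureToAbsIntegers 𝒪[F]) := by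
  haveI := isLocalRing_integralClosure_intermediateField F E
  haveI : (absMaximalIdeal F).IsMaximal := absMaximalIdeal_isMaximal_holds F
  haveI := isMaximal_comap_integralClosureToAbsIntegers 𝒪[F] (absMaximalIdeal F) E
  exact (IsLocalRing.eq_maximalIdeal inferInstance).symm

end DVR

/-! ### The character `θ₀ : G_0 → k_Eˣ` and its kernel `G_1` -/

section Theta

variable (F : Type*) [Field F] [ValuativeRel F] [TopologicalSpace F] [IsNonarchimedeanLocalField F]

/-- `𝔓 = absMaximalIdeal F` lies over `𝓂[F]`, as an instance (`under_absMaximalIdeal_holds`).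
Ref: Serre, *Local Fields*, Ch. II §2, Prop. 3. [folklore] -/
theorem absMaximalIdeal_liesOver_maximalIdeal : (absMaximalIdeal F).LiesOver 𝓂[F] :=
  ⟨(under_absMaximalIdeal_holds F).symm⟩

/-- The residue ring `O_E ⧸ 𝔓_E` of a finite separable subextension `E/F` of `F̄` is finite
(`O_E` is a finitely generated `𝒪[F]`-module and `𝔓_E` lies over `𝓂[F]`).
Ref: Serre, *Local Fields*, Ch. I §4, Prop. 9 ff. [folklore] -/
theorem finite_integralClosure_quotient (E : IntermediateField F (AlgebraicClosure F))
    [FiniteDimensional F E] [Algebra.IsSeparable F E] :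
    Finite (integralClosure 𝒪[F] E ⧸ (absMaximalIdeal F).comap (E.integralClosureToAbsIntegers 𝒪[F])) := by
  haveI := absMaximalIdeal_liesOver_maximalIdeal F
  haveI : IsNoetherian 𝒪[F] (integralClosure 𝒪[F] E) :=
    IsIntegralClosure.isNoetherian 𝒪[F] F E (integralClosure 𝒪[F] E)
  haveI : Finite (𝒪[F] ⧸ 𝓂[F]) := inferInstanceAs (Finite 𝓀[F])
  exact Module.finite_of_finite (𝒪[F] ⧸ 𝓂[F])

/-- The residue field `O_E ⧸ 𝔓_E` has characteristic `p = char 𝓀[F]` (`p ∈ 𝔓 ∩ O_E`). [folklore] -/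
theorem charP_integralClosure_quotient (E : IntermediateField F (AlgebraicClosure F)) :
    CharP (integralClosure 𝒪[F] E ⧸ (absMaximalIdeal F).comap (E.integralClosureToAbsIntegers 𝒪[F]))
      (ringChar 𝓀[F]) := by
  haveI : Fact (ringChar 𝓀[F]).Prime := ⟨CharP.char_is_prime 𝓀[F] _⟩
  haveI : Nontrivial (integralClosure 𝒪[F] E ⧸ (absMaximalIdeal F).comap (E.integralClosureToAbsIntegers 𝒪[F])) :=
    not_subsingleton_iff_nontrivial.mp
      (mt Ideal.Quotient.subsingleton_iff.mp (Ideal.comap_ne_top _ (absMaximalIdeal_ne_top F)))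
  refine (CharP.charP_iff_prime_eq_zero Fact.out).mpr ?_
  rw [← map_natCast (Ideal.Quotient.mk _), Ideal.Quotient.eq_zero_iff_mem, Ideal.mem_comap,
    map_natCast]
  exact IsFrobPow.natCast_ringChar_mem_absMaximalIdeal

-- the proof term is large (a bundled homomorphism built inside the proof); give the kernel room
set_option maxHeartbeats 800000 in
/-- **The tame character `θ₀` and its kernel.**  For a finite Galois subextension `E/F` of `F̄`
there is a homomorphism `θ₀` from the inertia group `G_0` of `𝔓_E` in `Gal(E/F)` to the units of
the residue field `O_E ⧸ 𝔓_E` (`σ ↦ σ(π)/π mod 𝔓_E` for a uniformiser `π` of the discrete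
valuation ring `O_E`) whose kernel is exactly the first ramification group `G_1`.
Ref: Serre, *Local Fields*, Ch. IV §2, Prop. 7 (the case `i = 0`: `G_0/G_1 ↪ U_L/U_L^1 = k_L^*`)
and §1, Prop. 1. [cite: SerreLocalFields1979, Ch. IV §2 Prop. 7] -/
theorem exists_inertiaCharacter (E : IntermediateField F (AlgebraicClosure F))
    [FiniteDimensional F E] [IsGalois F E] :
    ∃ θ : ↥(((absMaximalIdeal F).comap (E.integralClosureToAbsIntegers 𝒪[F])).inertia (E ≃ₐ[F] E)) →*
        (integralClosure 𝒪[F] E ⧸ (absMaximalIdeal F).comap (E.integralClosureToAbsIntegers 𝒪[F]))ˣ,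
      ∀ σ, θ σ = 1 ↔ (σ : E ≃ₐ[F] E) ∈
        ((absMaximalIdeal F).comap (E.integralClosureToAbsIntegers 𝒪[F])).ramificationSubgroup (E ≃ₐ[F] E) 1 := by
  classical
  -- notation
  set O := integralClosure 𝒪[F] E with hO
  set Q : Ideal O := (absMaximalIdeal F).comap (E.integralClosureToAbsIntegers 𝒪[F]) with hQdef
  haveI hDVR : IsDiscreteValuationRing O := isDiscreteValuationRing_integralClosure F E
  haveI : (absMaximalIdeal F).IsMaximal := absMaximalIdeal_isMaximal_holds F
  haveI hQmax : Q.IsMaximal := isMaximal_comap_integralClosureToAbsIntegers 𝒪[F] (absMaximalIdeal F) E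
  have hmQ : IsLocalRing.maximalIdeal O = Q := (IsLocalRing.eq_maximalIdeal hQmax).symm
  -- a uniformiser
  obtain ⟨π, hπ⟩ := IsDiscreteValuationRing.exists_irreducible O
  have hQπ : Q = Ideal.span {π} := by rw [← hmQ]; exact hπ.maximalIdeal_eq
  have hπQ : π ∈ Q := by rw [hQπ]; exact Ideal.mem_span_singleton_self π
  have hπ0 : π ≠ 0 := hπ.ne_zero
  -- `σ • Q = Q` and `σ • π = c σ * π`
  have hstab : ∀ σ : E ≃ₐ[F] E, σ • Q = Q := fun σ => smul_comap_absMaximalIdeal F E σ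
  have hex : ∀ σ : E ≃ₐ[F] E, ∃ c : O, c * π = σ • π := fun σ =>
    Ideal.mem_span_singleton'.mp (by rw [← hQπ, ← hstab σ]; exact Ideal.smul_mem_pointwise_smul σ π Q hπQ)
  choose c hc using hex
  -- `π ∉ Q ^ 2`, hence `σ • π ∉ Q ^ 2` and `c σ ∉ Q`
  have hπ2 : π ∉ Q ^ 2 := by
    rw [hQπ, Ideal.span_singleton_pow, Ideal.mem_span_singleton']
    rintro ⟨d, hd⟩
    apply hπ.not_isUnit
    have h1 : d * π * π = 1 * π := by rw [one_mul, mul_assoc, ← pow_two, hd]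
    have h2 : d * π = 1 := mul_right_cancel₀ hπ0 h1
    exact isUnit_iff_exists_inv.mpr ⟨d, by rw [mul_comm]; exact h2⟩
  have hcQ : ∀ σ, c σ ∉ Q := by
    intro σ hcσ
    apply hπ2
    have h1 : σ • π ∈ Q ^ 2 := by
      rw [← hc σ, pow_two]
      exact Ideal.mul_mem_mul hcσ hπQ
    have h2 : σ⁻¹ • (σ • π) ∈ σ⁻¹ • Q ^ 2 := Ideal.smul_mem_pointwise_smul σ⁻¹ (σ • π) (Q ^ 2) h1
    have h3 : σ⁻¹ • Q ^ 2 = Q ^ 2 := by rw [smul_pow', hstab]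
    rwa [inv_smul_smul, h3] at h2
  -- the homomorphism (into the multiplicative monoid of `O ⧸ Q`, then into units)
  set I : Subgroup (E ≃ₐ[F] E) := Q.inertia (E ≃ₐ[F] E) with hI
  have hcmul : ∀ σ τ : E ≃ₐ[F] E, σ ∈ I →
      Ideal.Quotient.mk Q (c (σ * τ)) = Ideal.Quotient.mk Q (c σ) * Ideal.Quotient.mk Q (c τ) := by
    intro σ τ hσ
    have h1 : c (σ * τ) * π = σ • c τ * c σ * π := by
      rw [hc, mul_smul, ← hc τ, smul_mul', ← hc σ]; ring
    have h2 : c (σ * τ) = σ • c τ * c σ := mul_right_cancel₀ hπ0 h1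
    have h3 : Ideal.Quotient.mk Q (σ • c τ) = Ideal.Quotient.mk Q (c τ) :=
      (Ideal.Quotient.eq.mpr (hσ (c τ)))
    rw [h2, map_mul, h3, mul_comm]
  let φ : ↥I →* (O ⧸ Q) :=
    { toFun := fun σ => Ideal.Quotient.mk Q (c σ)
      map_one' := by
        have h1 : c 1 * π = 1 * π := by rw [hc, one_mul]; exact one_smul _ π
        rw [OneMemClass.coe_one, mul_right_cancel₀ hπ0 h1, map_one]
      map_mul' := fun σ τ => by
        rw [Subgroup.coe_mul]
        exact hcmul σ τ σ.2 }
  have hφ : ∀ σ : I, φ σ = Ideal.Quotient.mk Q (c σ) := fun σ => rfl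
  refine ⟨φ.toHomUnits, fun σ => ?_⟩
  -- `θ σ = 1 ↔ c σ ≡ 1 ↔ σ • π - π ∈ Q ^ 2 ↔ σ ∈ G_1`
  have hσI : (σ : E ≃ₐ[F] E) ∈ I := σ.2
  have step1 : φ.toHomUnits σ = 1 ↔ c σ - 1 ∈ Q := by
    rw [Units.ext_iff, MonoidHom.coe_toHomUnits, Units.val_one, hφ, ← (Ideal.Quotient.mk Q).map_one,
      Ideal.Quotient.eq]
  have step2 : c σ - 1 ∈ Q ↔ (σ : E ≃ₐ[F] E) • π - π ∈ Q ^ 2 := by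
    have hfac : (σ : E ≃ₐ[F] E) • π - π = (c σ - 1) * π := by rw [sub_mul, one_mul, hc]
    rw [hfac, pow_two]
    constructor
    · intro h; exact Ideal.mul_mem_mul h hπQ
    · intro h
      rw [← pow_two, hQπ, Ideal.span_singleton_pow, Ideal.mem_span_singleton'] at h
      obtain ⟨d, hd⟩ := h
      rw [hQπ, Ideal.mem_span_singleton']
      refine ⟨d, mul_right_cancel₀ hπ0 ?_⟩
      rw [← hd]; ring
  rw [step1, step2, Ideal.mem_ramificationSubgroup_iff]
  constructor
  · intro hσπ
    refine ⟨hstab σ, fun x => ?_⟩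
    -- finite residue field: `x ^ q' ≡ x` and `q' ∈ Q`
    haveI : Finite (O ⧸ Q) := finite_integralClosure_quotient F E
    letI : Fintype (O ⧸ Q) := Fintype.ofFinite _
    obtain ⟨q', hq'⟩ : ∃ q' : ℕ, q' = Fintype.card (O ⧸ Q) := ⟨_, rfl⟩
    have hxq : x - x ^ q' ∈ Q := by
      letI : Field (O ⧸ Q) := Ideal.Quotient.field Q
      rw [← Ideal.Quotient.eq, map_pow, hq', FiniteField.pow_card]
    have hq'Q : ((q' : ℕ) : O) ∈ Q := by
      letI : Field (O ⧸ Q) := Ideal.Quotient.field Q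
      rw [← Ideal.Quotient.eq_zero_iff_mem, map_natCast, hq', FiniteField.cast_card_eq_zero]
    -- (1) `σ (x ^ q') - x ^ q' ∈ Q ^ 2`
    obtain ⟨n, hn⟩ : ∃ n : O, n = (σ : E ≃ₐ[F] E) • x - x := ⟨_, rfl⟩
    have hnQ : n ∈ Q := by rw [hn]; exact hσI x
    have h1 : (σ : E ≃ₐ[F] E) • (x ^ q') - x ^ q' ∈ Q ^ 2 := by
      have hsx : (σ : E ≃ₐ[F] E) • x = x + n := by rw [hn]; ring
      obtain ⟨r, hr⟩ := sq_dvd_add_pow_sub_sub n x q'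
      have hkey : (σ : E ≃ₐ[F] E) • (x ^ q') - x ^ q' = x ^ (q' - 1) * n * q' + n ^ 2 * r := by
        rw [smul_pow', hsx]
        linear_combination hr
      rw [hkey, pow_two, pow_two]
      refine Ideal.add_mem _ ?_ (Ideal.mul_mem_right _ _ (Ideal.mul_mem_mul hnQ hnQ))
      have : x ^ (q' - 1) * n * (q' : O) = (x ^ (q' - 1)) * (n * (q' : O)) := by ring
      rw [this]
      exact Ideal.mul_mem_left _ _ (Ideal.mul_mem_mul hnQ hq'Q)
    -- (2) `σ m - m ∈ Q ^ 2` for `m = x - x ^ q' = a * π`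
    obtain ⟨a, ha⟩ : ∃ a, a * π = x - x ^ q' := by
      rw [hQπ] at hxq; exact Ideal.mem_span_singleton'.mp hxq
    have h2 : (σ : E ≃ₐ[F] E) • (x - x ^ q') - (x - x ^ q') ∈ Q ^ 2 := by
      have hkey : (σ : E ≃ₐ[F] E) • (x - x ^ q') - (x - x ^ q') =
          (σ : E ≃ₐ[F] E) • a * ((σ : E ≃ₐ[F] E) • π - π) + ((σ : E ≃ₐ[F] E) • a - a) * π := by
        rw [← ha, smul_mul']; ring
      rw [hkey, pow_two]
      refine Ideal.add_mem _ (Ideal.mul_mem_left _ _ ?_) (Ideal.mul_mem_mul (hσI a) hπQ)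
      rw [← pow_two]; exact hσπ
    have hsplit : (σ : E ≃ₐ[F] E) • x - x =
        ((σ : E ≃ₐ[F] E) • (x ^ q') - x ^ q') + ((σ : E ≃ₐ[F] E) • (x - x ^ q') - (x - x ^ q')) := by
      rw [smul_sub]; ring
    rw [show (1 : ℕ) + 1 = 2 by rfl, hsplit]
    exact Ideal.add_mem _ h1 h2
  · rintro ⟨-, h⟩
    have := h π
    rwa [show (1 : ℕ) + 1 = 2 by rfl] at this

end Theta

/-! ### Consequence: tame images of the inertia group are cyclic of order prime to `p` -/

section Cyclic

variable (F : Type*) [Field F] [ValuativeRel F] [TopologicalSpace F] [IsNonarchimedeanLocalField F]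

-- quotient/range bookkeeping over the bundled `θ₀`; give the kernel room
set_option maxHeartbeats 800000 in
/-- **`G_0/G_1` is cyclic of order prime to `p` (in the form used downstream).**  For a finite
Galois subextension `E/F` of `F̄` and any homomorphism `f : Gal(E/F) → H` killing the first
ramification group `G_1` of `𝔓_E`, the image `f(G_0)` of the inertia group is cyclic of order
prime to `p = char 𝓀[F]`: it is a quotient of `G_0 / G_1`, which embeds by `θ₀`
(`exists_inertiaCharacter`) into the cyclic group `(O_E ⧸ 𝔓_E)ˣ` of order `#k_E - 1`.
Ref: Serre, *Local Fields*, Ch. IV §2, Cor. 1 of Prop. 7 ("`G_0/G_1` is cyclic of order prime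
to the characteristic of the residue field"). [cite: SerreLocalFields1979, Ch. IV §2 Cor. 1 of Prop. 7] -/
theorem isCyclic_map_inertia_of_forall_mem_ramificationSubgroup_one
    (E : IntermediateField F (AlgebraicClosure F)) [FiniteDimensional F E] [IsGalois F E]
    {H : Type*} [Group H] (f : (E ≃ₐ[F] E) →* H)
    (hf : ∀ σ ∈ ((absMaximalIdeal F).comap (E.integralClosureToAbsIntegers 𝒪[F])).ramificationSubgroup
      (E ≃ₐ[F] E) 1, f σ = 1) :
    IsCyclic ((((absMaximalIdeal F).comap (E.integralClosureToAbsIntegers 𝒪[F])).inertia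
        (E ≃ₐ[F] E)).map f) ∧
      (Nat.card ((((absMaximalIdeal F).comap (E.integralClosureToAbsIntegers 𝒪[F])).inertia
        (E ≃ₐ[F] E)).map f)).Coprime (ringChar 𝓀[F]) := by
  classical
  set O := integralClosure 𝒪[F] E with hO
  set Q : Ideal O := (absMaximalIdeal F).comap (E.integralClosureToAbsIntegers 𝒪[F]) with hQdef
  set I : Subgroup (E ≃ₐ[F] E) := Q.inertia (E ≃ₐ[F] E) with hI
  haveI : (absMaximalIdeal F).IsMaximal := absMaximalIdeal_isMaximal_holds F
  haveI hQmax : Q.IsMaximal := isMaximal_comap_integralClosureToAbsIntegers 𝒪[F] (absMaximalIdeal F) E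
  haveI : Finite (O ⧸ Q) := finite_integralClosure_quotient F E
  obtain ⟨θ, hθ⟩ := exists_inertiaCharacter F E
  -- `f` restricted to `I` factors through `I ⧸ ker θ`
  set f' : ↥I →* H := f.comp I.subtype with hf'
  have hker : θ.ker ≤ f'.ker := by
    intro σ hσ
    rw [MonoidHom.mem_ker] at hσ ⊢
    exact hf σ ((hθ σ).mp hσ)
  set g : ↥I ⧸ θ.ker →* H := QuotientGroup.lift θ.ker f' hker with hg
  have hrange : I.map f = g.range := by
    ext h
    constructor
    · rintro ⟨σ, hσ, rfl⟩
      exact ⟨QuotientGroup.mk ⟨σ, hσ⟩, by rw [hg, QuotientGroup.lift_mk]; rfl⟩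
    · rintro ⟨x, rfl⟩
      obtain ⟨σ, rfl⟩ := QuotientGroup.mk_surjective x
      exact ⟨σ, σ.2, by rw [hg, QuotientGroup.lift_mk]; rfl⟩
  -- `I ⧸ ker θ ≃ θ.range ≤ (O ⧸ Q)ˣ` is cyclic of order dividing `#(O ⧸ Q) - 1`
  have e : ↥I ⧸ θ.ker ≃* θ.range := QuotientGroup.quotientKerEquivRange θ
  haveI : IsCyclic (↥I ⧸ θ.ker) := isCyclic_of_surjective e.symm.toMonoidHom e.symm.surjective
  have hcard_dvd : Nat.card (↥I ⧸ θ.ker) ∣ Nat.card (O ⧸ Q)ˣ := by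
    rw [Nat.card_congr e.toEquiv]
    exact Subgroup.card_subgroup_dvd_card θ.range
  constructor
  · rw [hrange]
    exact isCyclic_of_surjective g.rangeRestrict g.rangeRestrict_surjective
  · rw [hrange]
    have h1 : Nat.card g.range ∣ Nat.card (↥I ⧸ θ.ker) :=
      Subgroup.card_dvd_of_surjective g.rangeRestrict g.rangeRestrict_surjective
    have hp : (ringChar 𝓀[F]).Prime := CharP.char_is_prime 𝓀[F] _
    -- `#(O ⧸ Q)` is a power of `p`, and `#(O ⧸ Q)ˣ = #(O ⧸ Q) - 1`
    obtain ⟨n, h2⟩ : ∃ n : ℕ+, Nat.card g.range ∣ (ringChar 𝓀[F]) ^ (n : ℕ) - 1 := by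
      letI : Field (O ⧸ Q) := Ideal.Quotient.field Q
      letI : Fintype (O ⧸ Q) := Fintype.ofFinite _
      haveI : CharP (O ⧸ Q) (ringChar 𝓀[F]) := charP_integralClosure_quotient F E
      obtain ⟨n, -, hn⟩ := FiniteField.card (O ⧸ Q) (ringChar 𝓀[F])
      refine ⟨n, ?_⟩
      have h2 : Nat.card g.range ∣ Nat.card (O ⧸ Q) - 1 := by
        rw [← Nat.card_units]; exact h1.trans hcard_dvd
      rwa [Nat.card_eq_fintype_card (α := O ⧸ Q), hn] at h2
    refine (Nat.Prime.coprime_iff_not_dvd hp).mpr (fun hdvd => ?_) |>.symm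
    have h3 : ringChar 𝓀[F] ∣ (ringChar 𝓀[F]) ^ (n : ℕ) - 1 := hdvd.trans h2
    have h4 : ringChar 𝓀[F] ∣ (ringChar 𝓀[F]) ^ (n : ℕ) := dvd_pow_self _ n.ne_zero
    have h5 : 1 ≤ (ringChar 𝓀[F]) ^ (n : ℕ) := Nat.one_le_pow _ _ hp.pos
    have := (Nat.dvd_sub_iff_right h5 h4).mp h3
    exact hp.ne_one (Nat.dvd_one.mp this)

end Cyclic

end Literature.NumberTheory.GaloisRepresentations
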